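import Literature.AlgebraicGeometry.KTheory.PullbackVectorBundle
import HarnessLib

/-!
# Pull-back of modules of bounded rank and of full flags along a morphism of schemes

For a morphism of schemes `f : X ⟶ Y` and the inverse-image functor
`f^* = AlgebraicGeometry.Scheme.Modules.pullback f : Y.Modules ⥤ X.Modules` (Mathlib), this file
completes `KTheory/PullbackVectorBundle` (pull-back of finite locally free modules and of short exact
sequences of vector bundles) with the rank-bounded and flagged versions consumed by the splitting
principle (Fulton §3.2, Grothendieck 1958 §2: "`f^*E` has a filtration by subbundles … with line
bundle quotients", iterated along a tower of projective bundles):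

* `HasRankLE.exists_free_iso_card_le`, `hasRankLE_of_free_iso_card_le` — the tree's bounded rank
  `Literature.AlgebraicGeometry.Motives.HasRankLE E r` (local generators data which are locally free
  with index sets of cardinality `≤ r`) in LOCAL form: near every point `𝒪^I ≅ E.over U` with `I`
  finite, `#I ≤ r` (Stacks 01C6 (2) with the rank bound);
* **`HasRankLE.pullback`** — `f^*` preserves `HasRankLE · r` (Stacks 01C8, Hartshorne II Ex. 5.1:
  `f^*` of a locally free sheaf of rank `≤ r` is locally free of rank `≤ r`: `(f^*E)|_{f⁻¹U} ≅
  (f ∣_ U)^* 𝒪_U^I ≅ 𝒪^I`, same index set);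
* `hasFullFlag_of_hasRankLE_one` — a module of rank `≤ 1` has a full flag (`0 → 0 → L → L → 0`);
* **`HasFullFlag.of_iso`** — full flags transport along isomorphisms of modules;
* **`HasFullFlag.pullback`** — `f^*` preserves full flags (induction along the flag: `f^*` preserves
  zero objects, short exact sequences with locally free cokernel — `shortExact_map_pullback_of_hasRankLE`
  — and rank `≤ 1`);
* `HasFullFlag.pullback_comp` — the flag of `(g ≫ f)^*E` from a flag of `g^*(f^*E)` (Mathlib
  `Scheme.Modules.pullbackComp`).

Everything is a theorem about Mathlib's `Scheme.Modules` and the tree's `HasRankLE` / `HasFullFlag`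
(`Motives/ChernClasses`); no definition, no named fact. Deliberate dot-notation extensions of
`Literature.AlgebraicGeometry.Motives.HasRankLE` / `HasFullFlag` from the `KTheory` directory.

## References

* [StacksProject] The Stacks project, Tags 01C6, 01C8.
* [Hartshorne1977] R. Hartshorne, *Algebraic Geometry* (1977), II.5 (Ex. 5.1 (d), Ex. 5.7).
* [Fulton1998] W. Fulton, *Intersection Theory*, 2nd ed. (1998), §3.2, §15.1.
* [Grothendieck1958] A. Grothendieck, *La théorie des classes de Chern* (1958), §2.
-/

universe u

open CategoryTheory Limits AlgebraicGeometry ZeroObject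
open Literature.AlgebraicGeometry.Motives

noncomputable section

namespace Literature.AlgebraicGeometry.KTheory

variable {X Y Z : Scheme.{u}}

/-! ## Bounded rank in local form -/

/-- **Local form of `HasRankLE`**: a module of rank `≤ r` is, near every point, free on a finite
index set of cardinality `≤ r` (the trivialisations of a `HasRankLE` datum at a member of the cover
containing the point). [cite: StacksProject, Tag 01C6] -/
theorem _root_.Literature.AlgebraicGeometry.Motives.HasRankLE.exists_free_iso_card_le
    {E : X.Modules} {r : ℕ} (h : HasRankLE E r) (x : X) :
    ∃ U : X.Opens, x ∈ U ∧ ∃ I : Type u, Finite I ∧ Nat.card I ≤ r ∧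
      Nonempty (SheafOfModules.free I ≅ E.over U) := by
  obtain ⟨q, hq, hr⟩ := h
  obtain ⟨a, ha⟩ := ((Opens.coversTop_iff _ q.X).mp q.coversTop).exists_mem x
  haveI := hq.isIso a
  exact ⟨q.X a, ha, (q.generators a).I, (hr a).1, (hr a).2, ⟨asIso (q.generators a).π⟩⟩

/-- **Conversely**, local trivialisations `𝒪^I ≅ E.over U` with `I` finite of cardinality `≤ r`
near every point give `HasRankLE E r` (the local generators data indexed by the points of `X`, as in
the tree's `IsFiniteLocallyFree.isVectorBundle`, with the rank bound carried along).
[cite: StacksProject, Tag 01C6] -/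
theorem _root_.Literature.AlgebraicGeometry.Motives.hasRankLE_of_free_iso_card_le {E : X.Modules}
    {r : ℕ} (h : ∀ x : X, ∃ U : X.Opens, x ∈ U ∧ ∃ I : Type u, Finite I ∧ Nat.card I ≤ r ∧
      Nonempty (SheafOfModules.free I ≅ E.over U)) :
    HasRankLE E r := by
  choose U hxU I hI hcard e using h
  let q : SheafOfModules.LocalGeneratorsData.{u} (R := X.ringCatSheaf) E :=
    { I := X
      X := U
      coversTop := (Opens.coversTop_iff _ U).mpr
        (TopologicalSpace.IsOpenCover.mk (eq_top_iff.mpr fun x _ ↦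
          TopologicalSpace.Opens.mem_iSup.mpr ⟨x, hxU x⟩))
      generators := fun x ↦
        (SheafOfModules.free.generatingSections (I x)).ofEpi (e x).some.hom }
  have hq : q.IsLocallyFreeData :=
    { isIso := fun x ↦ by
        change IsIso ((SheafOfModules.free.generatingSections (I x)).ofEpi (e x).some.hom).π
        rw [SheafOfModules.GeneratingSections.ofEpi_π]
        change IsIso ((SheafOfModules.free.generatingSections (I x)).π ≫ (e x).some.hom)
        infer_instance }
  exact ⟨q, hq, fun x ↦ ⟨hI x, hcard x⟩⟩

/-! ## Pull-back preserves bounded rank -/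

/-- **`f^*` preserves rank `≤ r`**: if `E` is locally free of rank `≤ r` on `Y` then so is `f^*E`
on `X` — near `x`, with `E.over U ≅ 𝒪^I` around `f x`, `(f^*E)|_{f⁻¹U} ≅ (f ∣_ U)^*(E|_U) ≅
(f ∣_ U)^* 𝒪_U^I ≅ 𝒪_{f⁻¹U}^I` (the tree's `nonempty_pullbackFreeIso`, `nonempty_restrictPullbackIso`;
Stacks 01C8). [cite: StacksProject, Tag 01C8] [cite: Hartshorne1977, II.5 Ex. 5.1 (d)] -/
theorem _root_.Literature.AlgebraicGeometry.Motives.HasRankLE.pullback {E : Y.Modules} {r : ℕ}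
    (hE : HasRankLE E r) (f : X ⟶ Y) :
    HasRankLE ((Scheme.Modules.pullback f).obj E) r := by
  refine hasRankLE_of_free_iso_card_le fun x ↦ ?_
  obtain ⟨U, hxU, I, hI, hcard, ⟨e⟩⟩ := hE.exists_free_iso_card_le (f.base x)
  obtain ⟨e'⟩ := nonempty_restrictIso_of_overIso e
  obtain ⟨e₁⟩ := nonempty_pullbackFreeIso (f ∣_ U) I
  obtain ⟨e₂⟩ := nonempty_restrictPullbackIso f U E
  obtain ⟨e₃⟩ := nonempty_overIso_of_restrictIso
    (e₁.symm ≪≫ (Scheme.Modules.pullback (f ∣_ U)).mapIso e' ≪≫ e₂.symm)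
  exact ⟨f ⁻¹ᵁ U, hxU, I, hI, hcard, ⟨e₃⟩⟩

/-! ## Full flags: rank `≤ 1`, isomorphisms, pull-back -/

/-- **A module of rank `≤ 1` has a full flag**: the one-step flag `0 → 0 → L → L → 0`.
[cite: Grothendieck1958, §2] -/
theorem _root_.Literature.AlgebraicGeometry.Motives.hasFullFlag_of_hasRankLE_one {L : X.Modules}
    (hL : HasRankLE L 1) : HasFullFlag L := by
  let S : ShortComplex X.Modules := ShortComplex.mk (0 : (0 : X.Modules) ⟶ L) (𝟙 L) (by simp)
  have hS : S.ShortExact :=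
    { exact := (S.exact_iff_mono rfl).2 (by change Mono (𝟙 L); infer_instance)
      mono_f := mono_of_source_iso_zero S.f (Iso.refl 0)
      epi_g := by change Epi (𝟙 L); infer_instance }
  exact HasFullFlag.of_shortExact S hS (HasFullFlag.of_isZero _ (isZero_zero _)) hL

/-- **Full flags transport along isomorphisms**: if `E ≅ E'` and `E` has a full flag then so has
`E'` (replace the last extension `0 → E₁ → E → L → 0` by `0 → E₁ → E' → L → 0`).
[cite: Grothendieck1958, §2] -/
theorem _root_.Literature.AlgebraicGeometry.Motives.HasFullFlag.of_iso {E E' : X.Modules}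
    (e : E ≅ E') (h : HasFullFlag E) : HasFullFlag E' := by
  cases h with
  | of_isZero _ hE => exact HasFullFlag.of_isZero E' (hE.of_iso e.symm)
  | of_shortExact S hS h₁ h₃ =>
    let S' : ShortComplex X.Modules :=
      ShortComplex.mk (S.f ≫ e.hom) (e.inv ≫ S.g) (by simp [S.zero])
    have hSS' : S'.ShortExact :=
      ShortComplex.shortExact_of_iso
        (ShortComplex.isoMk (S₁ := S) (S₂ := S') (Iso.refl _) e (Iso.refl _) (by simp [S'])
          (by simp [S'])) hS
    exact HasFullFlag.of_shortExact S' hSS' h₁ h₃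

/-- **`f^*` preserves full flags**: by induction along the flag, `f^*` sends zero modules to zero
modules (it is additive), short exact sequences `0 → E₁ → E → L → 0` with `L` of rank `≤ 1` to short
exact sequences (`shortExact_map_pullback_of_hasRankLE`: they are locally split), and preserves rank
`≤ 1` (`HasRankLE.pullback`) — "if `f : X' → X` is as in the splitting construction, `f^*E` has an
induced filtration". [cite: Fulton1998, §3.2 and §15.1] [cite: Grothendieck1958, §2] -/
theorem _root_.Literature.AlgebraicGeometry.Motives.HasFullFlag.pullback {E : Y.Modules}
    (h : HasFullFlag E) (f : X ⟶ Y) : HasFullFlag ((Scheme.Modules.pullback f).obj E) := by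
  induction h with
  | of_isZero E hE =>
    exact HasFullFlag.of_isZero _ ((Scheme.Modules.pullback f).map_isZero hE)
  | of_shortExact S hS h₁ h₃ ih =>
    exact HasFullFlag.of_shortExact (S.map (Scheme.Modules.pullback f))
      (shortExact_map_pullback_of_hasRankLE f hS h₃) ih (h₃.pullback f)

/-- **Flags along a composite**: a full flag of `g^*(f^*E)` gives a full flag of `(g ≫ f)^*E`
(Mathlib's pseudofunctoriality isomorphism `Scheme.Modules.pullbackComp`). [cite: Fulton1998, §15.1] -/
theorem _root_.Literature.AlgebraicGeometry.Motives.HasFullFlag.pullback_comp {E : Z.Modules}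
    (g : X ⟶ Y) (f : Y ⟶ Z)
    (h : HasFullFlag ((Scheme.Modules.pullback g).obj ((Scheme.Modules.pullback f).obj E))) :
    HasFullFlag ((Scheme.Modules.pullback (g ≫ f)).obj E) :=
  h.of_iso ((Scheme.Modules.pullbackComp g f).app E)

/-- In particular `(g ≫ f)^*E` has a full flag as soon as `f^*E` has one. [cite: Fulton1998, §3.2] -/
theorem _root_.Literature.AlgebraicGeometry.Motives.HasFullFlag.pullback_comp_of_pullback
    {E : Z.Modules} (g : X ⟶ Y) (f : Y ⟶ Z) (h : HasFullFlag ((Scheme.Modules.pullback f).obj E)) :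
    HasFullFlag ((Scheme.Modules.pullback (g ≫ f)).obj E) :=
  HasFullFlag.pullback_comp g f (h.pullback g)

end Literature.AlgebraicGeometry.KTheory

end
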